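import Literature.MathematicalPhysics.QuantumLattice.FermiRG.FSTInversionConvexCurve

/-!
# Feldman–Salmhofer–Trubowitz IV — Lemma 2 (the radial-derivative lemma of §2.1) — PROOF

J. Feldman, M. Salmhofer, E. Trubowitz, *An inversion theorem in Fermi surface theory*, Comm. Pure
Appl. Math. **53** (2000) 1350–1384 = arXiv:math-ph/0001031 [FeldmanSalmhoferTrubowitz2000]; render
`paper:arxiv-math-ph_0001031` (`lit read`), locators `p.N:Ln` = chunk `pNNNN.txt`, line `n` (stable
locators: "Lemma 2", "§2.1", "Appendix: Proof of Lemma (radderiv)").  Theorem-side companion of the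
FROZEN statement file `FermiRG/FSTInversion.lean` (optional DAG row `FSTinv.L1-3`, its L2 part, of the
`gate-hubbard-kl` typer wave); it consumes `FermiRG/FSTInversionConvexSurface.lean` /
`FermiRG/FSTInversionConvexCurve.lean` (FST IV Lemma 1, proved there) BY NAME.  No `sorry`, no
definition, no named fact (net fact debt 0): theorems only.

## The printed statement (§2.1, p.6:L61–83) and what polar coordinates mean there

> **Polar coordinates** (p.6:L13–27): "Consider a small ball `B` around an `E ∈ 𝓔`. Regard a small
> neighbourhood of the Fermi surface `S_E` as a subset of `ℝ^d` instead of the torus `𝓑` and introduce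
> polar coordinates `(r, θ) ∈ ℝ₀⁺ × S^{d−1}`, `𝐩 = 𝐩(r, θ)`. … the Fermi surface can be parametrized, for
> `e ∈ B`, as `S_e = {𝐩(r_F(e, θ), θ) : θ ∈ S^{d−1}}`."
>
> **Lemma 2.** Let `δ₀, g₀, w₀ > 0` and `G₀ > max{g₀, w₀}`. There are `ε, r₀, g₁ > 0` such that, for
> every `E ∈ 𝓔(δ₀, g₀, G₀, w₀)` and every `e ∈ B_ε^{(2)}(E)`, `e ∈ 𝓔(δ₀/2, g₀/2, 2G₀, w₀/2)` and
> (pfs) `|r_F(e, θ) − r_F(E, θ)| ≤ r₀` for all `θ ∈ S^{d−1}`,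
> (rg0) `∂/∂r e(𝐩(r, θ)) > g₁` for all `|r − r_F(E, θ)| ≤ 2r₀`, `θ ∈ S^{d−1}`.
> Note that the constants `ε, r₀` and `g₁` are independent of `E`.

Printed proof (Appendix "Proof of Lemma (radderiv)", p.20:L1–87): (A.1)–(A.2) the principal
curvatures of the level set `S_E` are `κ = (t, E″(𝐩)t)/‖∇E(𝐩)‖`, so "`S_E` is a convex surface that
is invariant under inversion in the origin and has all principal curvatures between `w₀/G₀` and
`G₀/g₀`"; (A.3) "By Lemma 1, `∂_r E(𝐩(r,θ)) = ∇E(𝐩(r,θ))·∂𝐩/∂r ≥ ‖∇E‖ (w₀/G₀)/(G₀/g₀) ≥ w₀g₀²/G₀²`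
for all `r = r_F(E, θ)`. Choose `g₁ = w₀g₀²/(4G₀²)` and `r₀ = min{g₁/G₀, δ₀}`"; (A.4)–(A.6) the radial
Lipschitz estimate `|[∇E(𝐩(r,θ)) − ∇E(𝐩(r_F,θ))]·∂𝐩/∂r| ≤ G₀|r − r_F|` gives `∂_r E ≥ 2g₁` for
`|r − r_F(E,θ)| ≤ 2r₀`; (A.7) "Similarly, if `|e − E|₁ ≤ g₁`, `∂_r e(𝐩(r,θ)) ≥ g₁`" there — "This
verifies (rg0). We merely need to choose `ε < g₁`"; (A.8) "if `|e − E|₀ ≤ r₀g₁`, then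
`|e(r_F(E,θ), θ)| ≤ r₀g₁` and hence `|r_F(e,θ) − r_F(E,θ)| ≤ r₀` by (rg0)"; and finally "The same argument
that shows that `𝓔` is open … also yields `e ∈ 𝓔(δ₀/2, g₀/2, 2G₀, w₀/2)`, if we choose `ε` small enough".

## What is proved, and how the hypotheses are typed (read this first)

**§A — the analytic core (A.3)–(A.8), in any real inner-product space `V`, along rays from the
centre.**  By Lemma 1 (symmetric clause) the centre of `S_E` is the origin, so the polar map is
`𝐩(r, θ) = r • θ` (`‖θ‖ = 1`), `∂𝐩/∂r = θ`, and for a function `E` with gradient field `∇E`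
(`HasGradientAt E (∇E x) x`) the radial derivative is `∂_r E(𝐩(r,θ)) = ⟪∇E(r•θ), θ⟫`
(`hasDerivAt_along_ray`).  A Fermi point is `𝐩 = ρ • θ`, `ρ = r_F(E, θ) > 0`.  Proved, with the
printed constants in the shape `4g₁ = c·g₀` (`c` = the cosine bound of Lemma 1), `G₀ r₀ ≤ g₁`:
`radialDeriv_ge_of_angle` (A.3), `radialDeriv_ge_on_collar` (A.4)–(A.6), `radialDeriv_ge_on_collar_of_near`
(A.7), `ray_slope` / `existsUnique_zero_on_collar` (A.8): `e` has EXACTLY ONE zero `r_F(e, θ)` on the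
collar ray `|r − ρ| ≤ 2r₀` and it satisfies `|r_F(e,θ) − ρ| ≤ r₀`; packaged as `lemma2_ray`.  The
hypotheses on `e` are the pointwise consequences of `|e − E|₁ ≤ g₁` and `|e − E|₀ ≤ r₀g₁` that the
proof uses (`‖∇e − ∇E‖ ≤ g₁` on the collar, `|e − E| ≤ r₀g₁` at the Fermi point).

**§B — `d = 2` (the `gate-hubbard-kl` programme's dimension): from the printed class hypotheses to §A,
with the printed constants `g₁ = w₀g₀²/(4G₀²)` VERBATIM.**  The Fermi curve of `E` is taken in the
support-function parametrisation of `FSTInversionConvexCurve.lean` (`γ = supportCurve h`, outward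
normal `e(φ) = unitVec φ`, tangent `e′(φ) = unitVec' φ`, `h ∈ C²` `2π`-periodic, centrally symmetric
`h(φ + π) = h(φ)` = the symmetric class `E(−𝐩) = E(𝐩)`, regular: `h + h″ > 0`), `E ∘ γ = 0`, with a
gradient field `∇E` and its derivative `E″ = D(∇E)` (`HasFDerivAt ∇E (E″ x) x`; the print's
"`E″(𝐩) t`" in (A.1) IS the derivative of the vector field `∇E` along `t`; for `E ∈ C²` these are
`gradient E` and a field `E″` with `⟪E″(x)v, w⟫ = D²E(x)(v,w) = iteratedFDeriv ℝ 2 E x ![v, w]`, the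
form of `FST3.hessQuad` — `hasGradientAt_gradient_and_hessian`).  Proved:
`inner_grad_unitVec'_eq_zero` (`∇E ⊥` tangent), `curvature_formula` = (A.1)–(A.2) in the form
`(h + h″)(φ) · (e′, E″(γ φ) e′) = ⟪∇E(γ φ), e(φ)⟫ = ‖∇E(γ φ)‖` (curvature radius `h + h″ = 1/κ`),
`inner_grad_unitVec_pos` (orientation: (iv) forces `∇E` outward, the Fermi sea is the inside),
`curvatureRadius_bounds` (class (ii) `‖∇E‖ > g₀`, (iii) `‖∇E‖, (t,E″t) ≤ G₀`, (iv) `(t, E″t) > w₀` ⇒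
`g₀/G₀ ≤ h + h″ ≤ G₀/w₀`, i.e. "principal curvatures between `w₀/G₀` and `G₀/g₀`"), then
`FST4.lemma1_plane_symmetric` ⇒ `cos θ(𝐩) ≥ (w₀/G₀)/(G₀/g₀)` (`angle_bound_symmetric`) ⇒ (A.3) with
`4g₁ = w₀g₀²/G₀²`; `existsUnique_fermiRadius` (every ray from the origin meets `S_E` exactly once:
the polar parametrisation `S_E = {𝐩(r_F(E,θ),θ)}` of p.6:L22–27 exists); and the package
`lemma2_plane` = Lemma 2 (rg0) (for `E` with `2g₁`, for `e` with `g₁`) and (pfs), for every point of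
`S_E`, with `g₁ = w₀g₀²/(4G₀²)` and any `0 < r₀ ≤ g₁/G₀` (so `r₀ = min{g₁/G₀, δ₀}` as printed);
`lemma2_plane_of_contDiff_two` = the same for `E ∈ C²` stated with `gradient E` and `iteratedFDeriv ℝ 2 E`.
The (iii)-type hypotheses are stated as the proof USES them (`‖∇E‖ ≤ G₀` on `S_E`, `(e′,E″e′) ≤ G₀`,
`∇E` `G₀`-Lipschitz = (A.5)); deriving them from "`|E|₂ < G₀`" in the coordinate norm of
`FST3.CkHolderNormLE` costs only the Cartesian/polar dimension constants the print waves through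
("It does not matter whether we use the norm in Cartesian or polar coordinates since the two are
equivalent", p.6:L151–152) and is left to the consumer that fixes the carrier (`Mom 2` vs `ℂ`).

## Scope — what is NOT asserted (the uniformity erratum, gate-hubbard-kl STATUS 2026-08-26 08:42:53Z)

The collar statements (rg0)/(pfs) hold with `ε, r₀, g₁` independent of `E`, exactly as printed and as
proved here.  The two remaining clauses — "`e ∈ 𝓔(δ₀/2, g₀/2, 2G₀, w₀/2)` for every `e ∈ B_ε^{(2)}(E)`"
and "`S_e ⊂ Ã`" (p.6:L105–106) with `ε` INDEPENDENT of `E` — are over-claimed as printed: `|E|₂ < G₀`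
gives no modulus of continuity of `E″` off `S_E` and no lower bound for `|E|` away from `S_E`, so an
`E ∈ 𝓔` with a flat near-zero dip far from `S_E` has perturbations `e = E − η`, `|e − E|₂ = η → 0`,
with extra Fermi pockets on which `|∇e|` is small (both clauses hold for each FIXED `E` with an
`ε = ε(E) > 0`, by compactness and the openness of `𝓔` — the per-`E` reading of the erratum; a bound on
`|E|₃` restores a uniform modulus for `E″` but not a uniform lower bound for `|E|` off `S_E`).  Neither
clause is stated here.
What is not formalised: `d ≥ 3` (no second fundamental form in Mathlib; §A is dimension-free, §B is
the plane), and the reparametrisation "`C²` closed convex curve ⟺ support function `h`" (as in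
`FSTInversionConvexCurve.lean`).

Typer lint: no `instance`, no `notation`, no attribute changes; no definitions.
-/

noncomputable section

open Metric Set
open scoped InnerProductSpace

namespace Literature.MathematicalPhysics.QuantumLattice.FermiRG

namespace FST4

/-! ### §A. Rays from the centre: the radial derivative and the collar estimates (A.3)–(A.8) -/

section Ray

variable {V : Type*} [NormedAddCommGroup V] [InnerProductSpace ℝ V] [CompleteSpace V]

/-- **The radial derivative in polar coordinates about the origin**: `𝐩(r, θ) = r • θ`, `∂𝐩/∂r = θ`,
and for `E` with gradient `∇E(r•θ) = g`, `∂/∂r E(𝐩(r,θ)) = ∇E(𝐩(r,θ)) · ∂𝐩/∂r = ⟪g, θ⟫` (the first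
equality of (A.3), p.20:L30–32).
[cite: FeldmanSalmhoferTrubowitz2000, Lemma 2 (proof) App. (A.3) p.20:L30-32; §2.1 p.6:L13-27] -/
theorem hasDerivAt_along_ray {E : V → ℝ} {g θ : V} {r : ℝ} (hE : HasGradientAt E g (r • θ)) :
    HasDerivAt (fun s : ℝ => E (s • θ)) ⟪g, θ⟫_ℝ r := by
  have h1 : HasDerivAt (fun s : ℝ => s • θ) ((1 : ℝ) • θ) r := (hasDerivAt_id r).smul_const θ
  rw [one_smul] at h1
  have h2 := hE.hasFDerivAt.comp_hasDerivAt r h1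
  rwa [InnerProductSpace.toDual_apply_apply] at h2

omit [CompleteSpace V] in
/-- **(A.3) — radial transversality at a Fermi point from Lemma 1's angle bound** (p.20:L25–37:
"By Lemma 1, `∂_r E(𝐩(r,θ)) = ∇E·∂𝐩/∂r ≥ ‖∇E(𝐩(r,θ))‖ (w₀/G₀)/(G₀/g₀) ≥ w₀g₀²/G₀²` for all
`r = r_F(E,θ)`"): if the angle `θ(𝐩)` between `𝐩` (centre `= 0`) and `g = ∇E(𝐩)` has `cos θ(𝐩) ≥ c ≥ 0`
(division-free: `c‖𝐩‖‖g‖ ≤ ⟪𝐩, g⟫`) and `‖g‖ ≥ g₀`, then along the unit radial vector `𝐩/‖𝐩‖`,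
`⟪g, 𝐩/‖𝐩‖⟫ ≥ c g₀` (in the print `c = (w₀/G₀)/(G₀/g₀)`, `c g₀ = w₀g₀²/G₀² = 4g₁`).
[cite: FeldmanSalmhoferTrubowitz2000, Lemma 2 (proof) App. (A.3) p.20:L25-37] -/
theorem radialDeriv_ge_of_angle {g p : V} {c g₀ : ℝ} (hp : p ≠ 0) (hc : 0 ≤ c)
    (hang : c * (‖p‖ * ‖g‖) ≤ ⟪p, g⟫_ℝ) (hg : g₀ ≤ ‖g‖) :
    c * g₀ ≤ ⟪g, ‖p‖⁻¹ • p⟫_ℝ := by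
  have hnp : 0 < ‖p‖ := norm_pos_iff.2 hp
  rw [real_inner_smul_right, real_inner_comm, ← mul_le_mul_iff_of_pos_left hnp]
  calc ‖p‖ * (c * g₀) = c * (‖p‖ * g₀) := by ring
    _ ≤ c * (‖p‖ * ‖g‖) := by gcongr
    _ ≤ ⟪p, g⟫_ℝ := hang
    _ = ‖p‖ * (‖p‖⁻¹ * ⟪p, g⟫_ℝ) := by field_simp

omit [CompleteSpace V] in
/-- **(A.4)–(A.6) — `∂_r E ≥ 2g₁` on the collar `|r − r_F(E,θ)| ≤ 2r₀`** (p.20:L37–63): with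
`∂_r E ≥ 4g₁` at the Fermi point `ρ•θ` ((A.3) and "Choose `g₁ = w₀g₀²/(4G₀²)`"), the splitting (A.4)
`∂_r E(𝐩(r,θ)) = ∇E(𝐩(r_F,θ))·∂𝐩/∂r + [∇E(𝐩(r,θ)) − ∇E(𝐩(r_F,θ))]·∂𝐩/∂r`, the Lipschitz estimate
(A.5) `|[…]·∂𝐩/∂r| ≤ G₀|r − r_F|` (here from `‖∇E(r•θ) − ∇E(ρ•θ)‖ ≤ G₀|r − ρ|`) and `r₀ ≤ g₁/G₀`
(typed `G₀ r₀ ≤ g₁`): (A.6) `∂_r E(𝐩(r,θ)) ≥ 2g₁` for all `|r − r_F(E,θ)| ≤ 2r₀`.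
[cite: FeldmanSalmhoferTrubowitz2000, Lemma 2 (proof) App. (A.4)-(A.6) p.20:L37-63] -/
theorem radialDeriv_ge_on_collar {gradE : V → V} {θ : V} (hθ : ‖θ‖ = 1) {ρ g₁ G₀ r₀ : ℝ}
    (h4 : 4 * g₁ ≤ ⟪gradE (ρ • θ), θ⟫_ℝ)
    (hLip : ∀ r : ℝ, |r - ρ| ≤ 2 * r₀ → ‖gradE (r • θ) - gradE (ρ • θ)‖ ≤ G₀ * |r - ρ|)
    (hG₀ : 0 ≤ G₀) (hr₀ : G₀ * r₀ ≤ g₁) :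
    ∀ r : ℝ, |r - ρ| ≤ 2 * r₀ → 2 * g₁ ≤ ⟪gradE (r • θ), θ⟫_ℝ := by
  intro r hr
  have hsplit : ⟪gradE (r • θ), θ⟫_ℝ =
      ⟪gradE (ρ • θ), θ⟫_ℝ + ⟪gradE (r • θ) - gradE (ρ • θ), θ⟫_ℝ := by
    rw [inner_sub_left]; ring
  have hcs : |⟪gradE (r • θ) - gradE (ρ • θ), θ⟫_ℝ| ≤ G₀ * |r - ρ| := by
    refine (abs_real_inner_le_norm _ _).trans ?_
    rw [hθ, mul_one]
    exact hLip r hr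
  have h3 : G₀ * |r - ρ| ≤ 2 * g₁ := by
    calc G₀ * |r - ρ| ≤ G₀ * (2 * r₀) := by gcongr
      _ = 2 * (G₀ * r₀) := by ring
      _ ≤ 2 * g₁ := by linarith
  rw [hsplit]
  linarith [(abs_le.1 (hcs.trans h3)).1]

omit [CompleteSpace V] in
/-- **(A.7) — `∂_r e ≥ g₁` on the collar** (p.20:L65–72: "Similarly, if `|e − E|₁ ≤ g₁`,
`∂_r e(𝐩(r,θ)) ≥ g₁` for all `|r − r_F(E,θ)| ≤ 2r₀, θ ∈ S^{d−1}`. This verifies (rg0). We merely need to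
choose `ε < g₁`"): from (A.6) for `E` and `‖∇e − ∇E‖ ≤ g₁` on the collar ray.
[cite: FeldmanSalmhoferTrubowitz2000, Lemma 2 (rg0) p.6:L78-79; proof App. (A.7) p.20:L65-72] -/
theorem radialDeriv_ge_on_collar_of_near {gradE grade : V → V} {θ : V} (hθ : ‖θ‖ = 1)
    {ρ g₁ r₀ : ℝ} (h2 : ∀ r : ℝ, |r - ρ| ≤ 2 * r₀ → 2 * g₁ ≤ ⟪gradE (r • θ), θ⟫_ℝ)
    (hnear : ∀ r : ℝ, |r - ρ| ≤ 2 * r₀ → ‖grade (r • θ) - gradE (r • θ)‖ ≤ g₁) :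
    ∀ r : ℝ, |r - ρ| ≤ 2 * r₀ → g₁ ≤ ⟪grade (r • θ), θ⟫_ℝ := by
  intro r hr
  have hsplit : ⟪grade (r • θ), θ⟫_ℝ =
      ⟪gradE (r • θ), θ⟫_ℝ + ⟪grade (r • θ) - gradE (r • θ), θ⟫_ℝ := by
    rw [inner_sub_left]; ring
  have hcs : |⟪grade (r • θ) - gradE (r • θ), θ⟫_ℝ| ≤ g₁ := by
    refine (abs_real_inner_le_norm _ _).trans ?_
    rw [hθ, mul_one]
    exact hnear r hr
  rw [hsplit]
  linarith [(abs_le.1 hcs).1, h2 r hr]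

/-- **Radial monotonicity with slope `g₁`** (the step "(pfs) … by (rg0)", p.20:L74–82): if
`∂_r e(𝐩(r,θ)) ≥ g₁` on the collar `|r − ρ| ≤ 2r₀`, then `e(𝐩(s,θ)) − e(𝐩(r,θ)) ≥ g₁ (s − r)` for
collar radii `r ≤ s` (mean value inequality).
[cite: FeldmanSalmhoferTrubowitz2000, Lemma 2 (pfs) p.6:L75-76; proof App. (A.8) p.20:L74-82] -/
theorem ray_slope {e : V → ℝ} {grade : V → V} (he : ∀ x, HasGradientAt e (grade x) x) {θ : V}
    {ρ g₁ r₀ : ℝ} (h1 : ∀ r : ℝ, |r - ρ| ≤ 2 * r₀ → g₁ ≤ ⟪grade (r • θ), θ⟫_ℝ) :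
    ∀ r s : ℝ, |r - ρ| ≤ 2 * r₀ → |s - ρ| ≤ 2 * r₀ → r ≤ s →
      g₁ * (s - r) ≤ e (s • θ) - e (r • θ) := by
  intro r s hr hs hrs
  have hd : ∀ x, HasDerivAt (fun t : ℝ => e (t • θ)) ⟪grade (x • θ), θ⟫_ℝ x :=
    fun x => hasDerivAt_along_ray (he _)
  have hcont : ContinuousOn (fun t : ℝ => e (t • θ)) (Icc (ρ - 2 * r₀) (ρ + 2 * r₀)) :=
    fun x _ => (hd x).continuousAt.continuousWithinAt
  have hdiff :
      DifferentiableOn ℝ (fun t : ℝ => e (t • θ)) (interior (Icc (ρ - 2 * r₀) (ρ + 2 * r₀))) :=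
    fun x _ => (hd x).differentiableAt.differentiableWithinAt
  have hge : ∀ x ∈ interior (Icc (ρ - 2 * r₀) (ρ + 2 * r₀)),
      g₁ ≤ deriv (fun t : ℝ => e (t • θ)) x := by
    intro x hx
    rw [(hd x).deriv]
    have hx' := interior_subset hx
    exact h1 x (abs_le.2 ⟨by linarith [hx'.1], by linarith [hx'.2]⟩)
  have hrI : r ∈ Icc (ρ - 2 * r₀) (ρ + 2 * r₀) :=
    ⟨by linarith [(abs_le.1 hr).1], by linarith [(abs_le.1 hr).2]⟩
  have hsI : s ∈ Icc (ρ - 2 * r₀) (ρ + 2 * r₀) :=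
    ⟨by linarith [(abs_le.1 hs).1], by linarith [(abs_le.1 hs).2]⟩
  exact (convex_Icc _ _).mul_sub_le_image_sub_of_le_deriv hcont hdiff hge r hrI s hsI hrs

/-- **(A.8) = (pfs) — the Fermi radius of `e` on the collar ray** (p.20:L74–82: "if `|e − E|₀ ≤ r₀g₁`,
then `|e(r_F(E,θ), θ)| ≤ r₀g₁` and hence `|r_F(e,θ) − r_F(E,θ)| ≤ r₀` by (rg0)"): if `∂_r e ≥ g₁ > 0` on
the collar `|r − ρ| ≤ 2r₀` and `|e(ρ•θ)| ≤ r₀g₁`, then `e` has EXACTLY ONE zero `r = r_F(e,θ)` on the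
collar ray, and `|r_F(e,θ) − ρ| ≤ r₀` (intermediate value theorem on `[ρ − r₀, ρ + r₀]` and strict
radial monotonicity).
[cite: FeldmanSalmhoferTrubowitz2000, Lemma 2 (pfs) p.6:L75-76; proof App. (A.8) p.20:L74-82] -/
theorem existsUnique_zero_on_collar {e : V → ℝ} {grade : V → V}
    (he : ∀ x, HasGradientAt e (grade x) x) {θ : V} {ρ g₁ r₀ : ℝ} (hg₁ : 0 < g₁) (hr₀ : 0 ≤ r₀)
    (h1 : ∀ r : ℝ, |r - ρ| ≤ 2 * r₀ → g₁ ≤ ⟪grade (r • θ), θ⟫_ℝ)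
    (h0 : |e (ρ • θ)| ≤ r₀ * g₁) :
    ∃ r : ℝ, |r - ρ| ≤ r₀ ∧ e (r • θ) = 0 ∧
      ∀ s : ℝ, |s - ρ| ≤ 2 * r₀ → e (s • θ) = 0 → s = r := by
  have hslope := ray_slope he h1
  have hd : ∀ x, HasDerivAt (fun t : ℝ => e (t • θ)) ⟪grade (x • θ), θ⟫_ℝ x :=
    fun x => hasDerivAt_along_ray (he _)
  have hcont : ContinuousOn (fun t : ℝ => e (t • θ)) (Icc (ρ - r₀) (ρ + r₀)) :=
    fun x _ => (hd x).continuousAt.continuousWithinAt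
  have hρ : |ρ - ρ| ≤ 2 * r₀ := by rw [sub_self, abs_zero]; positivity
  have hlo : |ρ - r₀ - ρ| ≤ 2 * r₀ := by
    rw [show ρ - r₀ - ρ = -r₀ by ring, abs_neg, abs_of_nonneg hr₀]; linarith
  have hhi : |ρ + r₀ - ρ| ≤ 2 * r₀ := by
    rw [show ρ + r₀ - ρ = r₀ by ring, abs_of_nonneg hr₀]; linarith
  have hneg : e ((ρ - r₀) • θ) ≤ 0 := by
    have := hslope (ρ - r₀) ρ hlo hρ (by linarith)
    have h0' := (abs_le.1 h0).2
    nlinarith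
  have hpos : 0 ≤ e ((ρ + r₀) • θ) := by
    have := hslope ρ (ρ + r₀) hρ hhi (by linarith)
    have h0' := (abs_le.1 h0).1
    nlinarith
  obtain ⟨r, hrI, hr0⟩ :=
    intermediate_value_Icc (by linarith : ρ - r₀ ≤ ρ + r₀) hcont ⟨hneg, hpos⟩
  have hr0' : e (r • θ) = 0 := hr0
  refine ⟨r, abs_le.2 ⟨by linarith [hrI.1], by linarith [hrI.2]⟩, hr0', fun s hs hs0 => ?_⟩
  have hr2 : |r - ρ| ≤ 2 * r₀ := abs_le.2 ⟨by linarith [hrI.1], by linarith [hrI.2]⟩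
  by_contra hne
  rcases lt_or_gt_of_ne hne with hlt | hgt
  · have := hslope s r hs hr2 hlt.le
    rw [hr0', hs0, sub_zero] at this
    nlinarith
  · have := hslope r s hr2 hs hgt.le
    rw [hr0', hs0, sub_zero] at this
    nlinarith

/-- **Lemma 2 along one ray, constants as printed** ("Choose `g₁ = w₀g₀²/(4G₀²)` and
`r₀ = min{g₁/G₀, δ₀}`", p.20:L37–39; here `4g₁ = c g₀` with `c` the cosine bound of Lemma 1 and any
`0 ≤ r₀` with `G₀r₀ ≤ g₁`).  Data: a unit direction `θ`, the Fermi point `𝐩 = ρ•θ` of `E` (`ρ > 0`,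
`E(𝐩) = 0`), `‖∇E(𝐩)‖ ≥ g₀`, the angle bound `c‖𝐩‖‖∇E(𝐩)‖ ≤ ⟪𝐩, ∇E(𝐩)⟫`, `∇E` `G₀`-Lipschitz along
the collar ray.  Then: (A.6) `∂_r E ≥ 2g₁` on `|r − ρ| ≤ 2r₀`; and for every `e` with gradient field
`∇e`, `‖∇e − ∇E‖ ≤ g₁` on the collar (from `|e − E|₁ ≤ g₁`): (rg0) `∂_r e ≥ g₁` there; if moreover
`|e − E| ≤ r₀g₁` at `𝐩` (from `|e − E|₀ ≤ r₀g₁`) and `g₁ > 0`: (pfs) `e` has exactly one zero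
`r_F(e,θ)` on the collar ray and `|r_F(e,θ) − ρ| ≤ r₀`.
[cite: FeldmanSalmhoferTrubowitz2000, Lemma 2 §2.1 p.6:L61-83; proof App. (A.3)-(A.8) p.20:L25-82] -/
theorem lemma2_ray {E : V → ℝ} {gradE : V → V} {θ : V} (hθ : ‖θ‖ = 1) {ρ c g₀ g₁ G₀ r₀ : ℝ}
    (hρ : 0 < ρ) (hE0 : E (ρ • θ) = 0) (hc : 0 ≤ c) (hg₁ : 4 * g₁ = c * g₀)
    (hang : c * (‖ρ • θ‖ * ‖gradE (ρ • θ)‖) ≤ ⟪ρ • θ, gradE (ρ • θ)⟫_ℝ)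
    (hii : g₀ ≤ ‖gradE (ρ • θ)‖)
    (hLip : ∀ r : ℝ, |r - ρ| ≤ 2 * r₀ → ‖gradE (r • θ) - gradE (ρ • θ)‖ ≤ G₀ * |r - ρ|)
    (hG₀ : 0 ≤ G₀) (hr₀ : 0 ≤ r₀) (hr₀' : G₀ * r₀ ≤ g₁) :
    (∀ r : ℝ, |r - ρ| ≤ 2 * r₀ → 2 * g₁ ≤ ⟪gradE (r • θ), θ⟫_ℝ) ∧
      ∀ (e : V → ℝ) (grade : V → V), (∀ x, HasGradientAt e (grade x) x) →
        (∀ r : ℝ, |r - ρ| ≤ 2 * r₀ → ‖grade (r • θ) - gradE (r • θ)‖ ≤ g₁) →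
          (∀ r : ℝ, |r - ρ| ≤ 2 * r₀ → g₁ ≤ ⟪grade (r • θ), θ⟫_ℝ) ∧
            (0 < g₁ → |e (ρ • θ) - E (ρ • θ)| ≤ r₀ * g₁ →
              ∃ r : ℝ, |r - ρ| ≤ r₀ ∧ e (r • θ) = 0 ∧
                ∀ s : ℝ, |s - ρ| ≤ 2 * r₀ → e (s • θ) = 0 → s = r) := by
  have hp : ρ • θ ≠ 0 := by
    rw [smul_ne_zero_iff]
    exact ⟨hρ.ne', fun h0 => by simp [h0] at hθ⟩
  have hunit : ‖ρ • θ‖⁻¹ • (ρ • θ) = θ := by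
    rw [norm_smul, Real.norm_of_nonneg hρ.le, hθ, mul_one, smul_smul, inv_mul_cancel₀ hρ.ne',
      one_smul]
  have hA3 := radialDeriv_ge_of_angle hp hc hang hii
  rw [hunit, ← hg₁] at hA3
  have hA6 := radialDeriv_ge_on_collar hθ hA3 hLip hG₀ hr₀'
  refine ⟨hA6, fun e grade he hnear => ?_⟩
  have hA7 := radialDeriv_ge_on_collar_of_near hθ hA6 hnear
  refine ⟨hA7, fun hg₁pos h0 => ?_⟩
  rw [hE0, sub_zero] at h0
  exact existsUnique_zero_on_collar he hg₁pos hr₀ hA7 h0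

end Ray

/-! ### §B. The plane (`d = 2`): the level-curve curvature formula (A.1)–(A.2), the class bounds, and
Lemma 2 with `g₁ = w₀g₀²/(4G₀²)` -/

section Plane

/-- `e(ψ) = e^{iψ}` has derivative `e′(ψ) = i e^{iψ}` (the tangent direction).
[cite: FeldmanSalmhoferTrubowitz2000, §2.1 (polar coordinates, d = 2) p.6:L13-27] -/
theorem hasDerivAt_unitVec (ψ : ℝ) : HasDerivAt unitVec (unitVec' ψ) ψ := by
  have h1 : HasDerivAt (fun x : ℝ => Complex.exp ((x : ℂ) * Complex.I))
      (Complex.exp ((ψ : ℂ) * Complex.I) * ((1 : ℝ) * Complex.I)) ψ :=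
    (((hasDerivAt_id ψ).ofReal_comp).mul_const Complex.I).cexp
  have h2 : Complex.exp ((ψ : ℂ) * Complex.I) * ((1 : ℝ) * Complex.I) = unitVec' ψ := by
    rw [unitVec', unitVec]; push_cast; ring
  rw [h2] at h1
  exact h1

/-- `e′(ψ) = i e(ψ)` has derivative `−e(ψ)`. [cite: FeldmanSalmhoferTrubowitz2000, §2.1 (polar coordinates, d = 2) p.6:L13-27] -/
theorem hasDerivAt_unitVec' (ψ : ℝ) : HasDerivAt unitVec' (-unitVec ψ) ψ := by
  have h1 : HasDerivAt (fun x : ℝ => Complex.I * unitVec x) (Complex.I * unitVec' ψ) ψ :=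
    (hasDerivAt_unitVec ψ).const_mul Complex.I
  have h2 : Complex.I * unitVec' ψ = -unitVec ψ := by
    rw [unitVec', ← mul_assoc, Complex.I_mul_I, neg_one_mul]
  rw [h2] at h1
  exact h1

/-- `‖e′(ψ)‖ = 1` (unit tangent). [cite: FeldmanSalmhoferTrubowitz2000, §1.2 (iv) (unit tangent vectors) p.4:L40-43] -/
theorem norm_unitVec' (ψ : ℝ) : ‖unitVec' ψ‖ = 1 := by
  rw [unitVec', norm_mul, Complex.norm_I, norm_unitVec, one_mul]

/-- `⟪e(φ), e′(φ)⟫ = 0` (normal ⊥ tangent). [cite: FeldmanSalmhoferTrubowitz2000, §1.2 (iv) (tangent vectors) p.4:L40-43] -/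
theorem inner_unitVec_unitVec'_self (φ : ℝ) : ⟪unitVec φ, unitVec' φ⟫_ℝ = 0 := by
  rw [real_inner_comm, inner_unitVec'_unitVec, sub_self, Real.sin_zero]

/-! #### The `C²` dictionary: gradient field `∇E` and Hessian `E″ = D(∇E)` with `(v, E″w) = D²E(v,w)` -/

/-- `⟪a·1 + b·i, w⟫ = a Re w + b Im w` (plane coordinates). [folklore] -/
private theorem inner_smul_one_add_smul_I (a b : ℝ) (w : ℂ) :
    ⟪a • (1 : ℂ) + b • Complex.I, w⟫_ℝ = a * w.re + b * w.im := by
  rw [inner_add_left, real_inner_smul_left, real_inner_smul_left, Complex.inner, Complex.inner]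
  simp

/-- A real-linear functional on the plane in coordinates: `L w = Re w · L 1 + Im w · L i`. [folklore] -/
private theorem clm_apply_eq_re_im (L : ℂ →L[ℝ] ℝ) (w : ℂ) :
    L w = w.re * L 1 + w.im * L Complex.I := by
  conv_lhs => rw [← Complex.re_add_im w]
  rw [map_add]
  have h1 : L (w.re : ℂ) = w.re * L 1 := by
    rw [show ((w.re : ℝ) : ℂ) = (w.re : ℝ) • (1 : ℂ) by simp, map_smul, smul_eq_mul]
  have h2 : L ((w.im : ℂ) * Complex.I) = w.im * L Complex.I := by
    rw [show ((w.im : ℝ) : ℂ) * Complex.I = (w.im : ℝ) • Complex.I by simp, map_smul, smul_eq_mul]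
  rw [h1, h2]

/-- **The `C²` dictionary** for the hypotheses of this section: for `E ∈ C²(ℝ², ℝ)` the gradient
field `∇E = gradient E` is a gradient of `E` everywhere and has a derivative `E″ = D(∇E)` (a field of
real-linear maps) with `⟪E″(x) v, w⟫ = D²E(x)(v, w)` (`iteratedFDeriv ℝ 2 E x ![v, w]`, the form of
`FST3.hessQuad`); so the print's "`(t, E″(𝐩) t)`" of §1.2 (iv) and (A.1)–(A.2) is `⟪E″(𝐩) t, t⟫`
with `E″` the derivative of the vector field `∇E` — exactly how it enters (A.1),
"`d/ds ∇E(q(s)) = E″(𝐩) t`".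
[cite: FeldmanSalmhoferTrubowitz2000, Lemma 2 (proof) App. (A.1)-(A.2) p.20:L3-23; §1.2 (iv) p.4:L40-43] -/
theorem hasGradientAt_gradient_and_hessian {E : ℂ → ℝ} (hE : ContDiff ℝ 2 E) :
    (∀ x, HasGradientAt E (gradient E x) x) ∧
      ∃ D : ℂ → (ℂ →L[ℝ] ℂ), (∀ x, HasFDerivAt (gradient E) (D x) x) ∧
        ∀ x v w : ℂ, ⟪D x v, w⟫_ℝ = iteratedFDeriv ℝ 2 E x ![v, w] := by
  have hd1 : ∀ x, HasFDerivAt E (fderiv ℝ E x) x :=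
    fun x => (hE.differentiable (by norm_num) x).hasFDerivAt
  have hE1 : ContDiff ℝ 1 (fderiv ℝ E) := hE.fderiv_right (m := 1) (by norm_num)
  have hd2 : ∀ x, HasFDerivAt (fderiv ℝ E) (fderiv ℝ (fderiv ℝ E) x) x :=
    fun x => (hE1.differentiable (by norm_num) x).hasFDerivAt
  -- the gradient in coordinates: `∇E(x) = (∂E/∂x₁) · 1 + (∂E/∂x₂) · i`
  have hgrad : ∀ x, HasGradientAt E ((fderiv ℝ E x 1) • (1 : ℂ) + (fderiv ℝ E x Complex.I) • Complex.I) x := by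
    intro x
    rw [hasGradientAt_iff_hasFDerivAt]
    refine (hd1 x).congr_fderiv ?_
    ext w
    rw [InnerProductSpace.toDual_apply_apply, inner_smul_one_add_smul_I, clm_apply_eq_re_im]
    ring
  have hgeq : gradient E = fun x => (fderiv ℝ E x 1) • (1 : ℂ) + (fderiv ℝ E x Complex.I) • Complex.I :=
    funext fun x => (hgrad x).gradient
  refine ⟨fun x => hgeq ▸ hgrad x,
    fun x => (((ContinuousLinearMap.apply ℝ ℝ (1 : ℂ)).comp (fderiv ℝ (fderiv ℝ E) x)).smulRight
        (1 : ℂ)) +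
      (((ContinuousLinearMap.apply ℝ ℝ Complex.I).comp (fderiv ℝ (fderiv ℝ E) x)).smulRight
        Complex.I), fun x => ?_, fun x v w => ?_⟩
  · have h1 : HasFDerivAt (fun y => fderiv ℝ E y 1)
        ((ContinuousLinearMap.apply ℝ ℝ (1 : ℂ)).comp (fderiv ℝ (fderiv ℝ E) x)) x :=
      (ContinuousLinearMap.apply ℝ ℝ (1 : ℂ)).hasFDerivAt.comp x (hd2 x)
    have h2 : HasFDerivAt (fun y => fderiv ℝ E y Complex.I)
        ((ContinuousLinearMap.apply ℝ ℝ Complex.I).comp (fderiv ℝ (fderiv ℝ E) x)) x :=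
      (ContinuousLinearMap.apply ℝ ℝ Complex.I).hasFDerivAt.comp x (hd2 x)
    rw [hgeq]
    exact (h1.smul_const (1 : ℂ)).add (h2.smul_const Complex.I)
  · simp only [add_apply, ContinuousLinearMap.smulRight_apply, ContinuousLinearMap.comp_apply,
      ContinuousLinearMap.apply_apply]
    rw [inner_smul_one_add_smul_I, iteratedFDeriv_two_apply]
    simp only [Matrix.cons_val_zero, Matrix.cons_val_one]
    rw [clm_apply_eq_re_im ((fderiv ℝ (fderiv ℝ E) x) v) w]
    ring

variable (h : ℝ → ℝ)

/-- **`γ′(φ) = (h(φ) + h″(φ)) e′(φ)`**: the support-parametrised curve is `C¹` with velocity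
`ρ(φ) e′(φ)`, `ρ = h + h″` the radius of curvature (the "curve on `S_E` … with tangent vector `t`" of
(A.1), p.20:L3–6, here parametrised by the normal angle instead of arc length).
[cite: FeldmanSalmhoferTrubowitz2000, Lemma 2 (proof) App. (A.1) p.20:L3-10] -/
theorem hasDerivAt_supportCurve (hh : ContDiff ℝ 2 h) (φ : ℝ) :
    HasDerivAt (supportCurve h) ((h φ + iteratedDeriv 2 h φ) • unitVec' φ) φ := by
  obtain ⟨h0, h1⟩ := hasDerivAt_of_contDiff_two h hh φ
  have hA : HasDerivAt (fun ψ => h ψ • unitVec ψ) (h φ • unitVec' φ + deriv h φ • unitVec φ) φ :=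
    h0.smul (hasDerivAt_unitVec φ)
  have hB : HasDerivAt (fun ψ => deriv h ψ • unitVec' ψ)
      (deriv h φ • -unitVec φ + iteratedDeriv 2 h φ • unitVec' φ) φ :=
    h1.smul (hasDerivAt_unitVec' φ)
  have hC := hA.add hB
  have heq : h φ • unitVec' φ + deriv h φ • unitVec φ +
      (deriv h φ • -unitVec φ + iteratedDeriv 2 h φ • unitVec' φ) =
      (h φ + iteratedDeriv 2 h φ) • unitVec' φ := by
    rw [smul_neg, add_smul]; abel
  rw [heq] at hC
  exact hC

/-- **`∇E` is normal to the Fermi curve**: if `E ∘ γ = 0` (`S_E ⊇` the curve) and `ρ(φ) > 0`, then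
`⟪∇E(γ(φ)), e′(φ)⟫ = 0` (differentiate `E(γ(φ)) = 0`: `ρ ⟪∇E, e′⟫ = 0`).  This is the level-set
identity behind (A.1) ("`∇E(q(s))/‖∇E(q(s))‖`" is the unit normal along the curve, p.20:L10–12).
[cite: FeldmanSalmhoferTrubowitz2000, Lemma 2 (proof) App. (A.1) p.20:L3-10] -/
theorem inner_grad_unitVec'_eq_zero {E : ℂ → ℝ} {gradE : ℂ → ℂ}
    (hE : ∀ x, HasGradientAt E (gradE x) x) (hh : ContDiff ℝ 2 h) {φ : ℝ}
    (hρ : 0 < h φ + iteratedDeriv 2 h φ) (hF : ∀ ψ, E (supportCurve h ψ) = 0) :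
    ⟪gradE (supportCurve h φ), unitVec' φ⟫_ℝ = 0 := by
  have h1 : HasDerivAt (fun ψ => E (supportCurve h ψ))
      (⟪gradE (supportCurve h φ), (h φ + iteratedDeriv 2 h φ) • unitVec' φ⟫_ℝ) φ := by
    have h3 := (hE _).hasFDerivAt.comp_hasDerivAt φ (hasDerivAt_supportCurve h hh φ)
    rwa [InnerProductSpace.toDual_apply_apply] at h3
  have h2 : HasDerivAt (fun ψ => E (supportCurve h ψ)) 0 φ := by
    have h4 : (fun ψ => E (supportCurve h ψ)) = fun _ => 0 := funext hF
    rw [h4]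
    exact hasDerivAt_const φ 0
  have h3 := h1.unique h2
  rw [real_inner_smul_right] at h3
  exact (mul_eq_zero.1 h3).resolve_left hρ.ne'

/-- **`∇E(γ(φ)) = ⟪∇E(γ(φ)), e(φ)⟫ e(φ)`**: the gradient on the Fermi curve is a multiple of the
normal `e(φ)` (its tangential component vanishes), so `‖∇E(γ(φ))‖ = |⟪∇E(γ(φ)), e(φ)⟫|` and, when
that coefficient is positive, `e(φ) = ∇E/‖∇E‖` is the print's outward normal `𝐧(𝐩)`.
[cite: FeldmanSalmhoferTrubowitz2000, Lemma 2 (proof) App. (A.1)-(A.3) p.20:L3-37] -/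
theorem grad_eq_smul_unitVec {E : ℂ → ℝ} {gradE : ℂ → ℂ}
    (hE : ∀ x, HasGradientAt E (gradE x) x) (hh : ContDiff ℝ 2 h) {φ : ℝ}
    (hρ : 0 < h φ + iteratedDeriv 2 h φ) (hF : ∀ ψ, E (supportCurve h ψ) = 0) :
    gradE (supportCurve h φ) = (⟪gradE (supportCurve h φ), unitVec φ⟫_ℝ) • unitVec φ := by
  have h1 := eq_smul_unitVec_add (gradE (supportCurve h φ)) φ
  rw [inner_grad_unitVec'_eq_zero h hE hh hρ hF, zero_smul, add_zero] at h1
  exact h1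

/-- **(A.1)–(A.2) — the curvature of a level curve**: "`κ = (t, E″(𝐩)t)/‖∇E(𝐩)‖`" (p.20:L3–23), in
the support parametrisation (`κ = 1/ρ`, `ρ = h + h″`, unit tangent `t = e′(φ)`, `E″ = D(∇E)` the
derivative of the gradient field — the print's "`E″(𝐩)t = d/ds ∇E(q(s))`"): for `E` with `E ∘ γ = 0`,
`ρ(φ) · ⟪E″(γ(φ)) e′(φ), e′(φ)⟫ = ⟪∇E(γ(φ)), e(φ)⟫` (`= ‖∇E(γ(φ))‖` for the outward orientation).
Proof: differentiate the tangency `⟪∇E(γ(ψ)), e′(ψ)⟫ ≡ 0` once (`γ′ = ρe′`, `e″ = −e`).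
[cite: FeldmanSalmhoferTrubowitz2000, Lemma 2 (proof) App. (A.1)-(A.2) p.20:L3-23] -/
theorem curvature_formula {E : ℂ → ℝ} {gradE : ℂ → ℂ} {D : ℂ → (ℂ →L[ℝ] ℂ)}
    (hE : ∀ x, HasGradientAt E (gradE x) x) (hD : ∀ x, HasFDerivAt gradE (D x) x)
    (hh : ContDiff ℝ 2 h) (hρ : ∀ ψ, 0 < h ψ + iteratedDeriv 2 h ψ)
    (hF : ∀ ψ, E (supportCurve h ψ) = 0) (φ : ℝ) :
    (h φ + iteratedDeriv 2 h φ) * ⟪D (supportCurve h φ) (unitVec' φ), unitVec' φ⟫_ℝ =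
      ⟪gradE (supportCurve h φ), unitVec φ⟫_ℝ := by
  have hT0 : (fun ψ => ⟪gradE (supportCurve h ψ), unitVec' ψ⟫_ℝ) = fun _ => (0 : ℝ) :=
    funext fun ψ => inner_grad_unitVec'_eq_zero h hE hh (hρ ψ) hF
  have hG : HasDerivAt (fun ψ => gradE (supportCurve h ψ))
      (D (supportCurve h φ) ((h φ + iteratedDeriv 2 h φ) • unitVec' φ)) φ :=
    (hD _).comp_hasDerivAt φ (hasDerivAt_supportCurve h hh φ)
  have hT : HasDerivAt (fun ψ => ⟪gradE (supportCurve h ψ), unitVec' ψ⟫_ℝ)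
      (⟪gradE (supportCurve h φ), -unitVec φ⟫_ℝ +
        ⟪D (supportCurve h φ) ((h φ + iteratedDeriv 2 h φ) • unitVec' φ), unitVec' φ⟫_ℝ) φ :=
    hG.inner ℝ (hasDerivAt_unitVec' φ)
  rw [hT0] at hT
  have h0 := hT.unique (hasDerivAt_const φ (0 : ℝ))
  rw [map_smul, real_inner_smul_left, inner_neg_right] at h0
  linarith

/-- **Orientation: `∇E` points outward** — the Fermi sea `{E < 0}` is the inside of the curve: if
the curvature form is positive on the curve, `(e′, E″e′) > 0` (class (iv)), then the normal coefficient
`m(φ) = ⟪∇E(γ(φ)), e(φ)⟫ = ρ(φ)(e′, E″e′)` is positive and equals `‖∇E(γ(φ))‖`; so `e(φ) = ∇E/‖∇E‖`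
is the outward normal `𝐧(𝐩)` of Lemma 1, as (A.3) uses it.
[cite: FeldmanSalmhoferTrubowitz2000, Lemma 2 (proof) App. (A.1)-(A.3) p.20:L3-37; §1.2 (iv) p.4:L40-43] -/
theorem inner_grad_unitVec_pos {E : ℂ → ℝ} {gradE : ℂ → ℂ} {D : ℂ → (ℂ →L[ℝ] ℂ)}
    (hE : ∀ x, HasGradientAt E (gradE x) x) (hD : ∀ x, HasFDerivAt gradE (D x) x)
    (hh : ContDiff ℝ 2 h) (hρ : ∀ ψ, 0 < h ψ + iteratedDeriv 2 h ψ)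
    (hF : ∀ ψ, E (supportCurve h ψ) = 0)
    (hiv : ∀ ψ, 0 < ⟪D (supportCurve h ψ) (unitVec' ψ), unitVec' ψ⟫_ℝ) (φ : ℝ) :
    0 < ⟪gradE (supportCurve h φ), unitVec φ⟫_ℝ ∧
      ‖gradE (supportCurve h φ)‖ = ⟪gradE (supportCurve h φ), unitVec φ⟫_ℝ := by
  have hm : 0 < ⟪gradE (supportCurve h φ), unitVec φ⟫_ℝ := by
    rw [← curvature_formula h hE hD hh hρ hF φ]
    exact mul_pos (hρ φ) (hiv φ)
  refine ⟨hm, ?_⟩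
  conv_lhs => rw [grad_eq_smul_unitVec h hE hh (hρ φ) hF]
  rw [norm_smul, Real.norm_of_nonneg hm.le, norm_unitVec, mul_one]

/-- **"All principal curvatures between `w₀/G₀` and `G₀/g₀`"** (p.20:L25–27), i.e. the curvature
RADIUS `ρ = ‖∇E‖/(t, E″t)` lies in `[g₀/G₀, G₀/w₀] = [1/K, 1/k]`, `K = G₀/g₀`, `k = w₀/G₀`: from the class
bounds (ii) `‖∇E‖ ≥ g₀` (here `m ≥ g₀`), (iii) `‖∇E‖ ≤ G₀` and `(t, E″t) ≤ G₀`, (iv) `(t, E″t) > w₀`,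
and the curvature formula `ρ · (t,E″t) = m = ‖∇E‖`.  Pure arithmetic.
[cite: FeldmanSalmhoferTrubowitz2000, Lemma 2 (proof) App. (A.2) p.20:L18-27; §1.2 (ii)-(iv) p.4:L38-43] -/
theorem curvatureRadius_bounds {ρ m Q g₀ G₀ w₀ : ℝ} (hρQ : ρ * Q = m) (hg₀ : 0 < g₀)
    (hw₀ : 0 < w₀) (hmg : g₀ ≤ m) (hmG : m ≤ G₀) (hQw : w₀ < Q) (hQG : Q ≤ G₀) :
    (G₀ / g₀)⁻¹ ≤ ρ ∧ ρ ≤ (w₀ / G₀)⁻¹ := by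
  have hQ : 0 < Q := hw₀.trans hQw
  have hG₀ : 0 < G₀ := hQ.trans_le hQG
  have hρ : ρ = m / Q := by rw [← hρQ, mul_div_cancel_right₀ _ hQ.ne']
  rw [inv_div, inv_div, hρ]
  constructor
  · rw [div_le_div_iff₀ hG₀ hQ]
    nlinarith
  · rw [div_le_div_iff₀ hQ hw₀]
    nlinarith

/-- **Lemma 1 ⇒ the angle hypothesis of (A.3), symmetric plane curve** (p.20:L25–37: "`S_E` is a
convex surface that is invariant under inversion in the origin and has all principal curvatures between
`w₀/G₀` and `G₀/g₀`. By Lemma 1, `∂_r E ≥ ‖∇E‖ (w₀/G₀)/(G₀/g₀)`"): for `h ∈ C²`, `2π`-periodic,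
`h(φ+π) = h(φ)`, with `g₀/G₀ ≤ h + h″ ≤ G₀/w₀`, and a vector `g = m e(φ)`, `m ≥ 0` (the gradient on the
curve, `grad_eq_smul_unitVec`), the cosine of the angle between `γ(φ)` and `g` is at least
`(w₀/G₀)/(G₀/g₀) = w₀g₀/G₀²`: `(w₀g₀/G₀²)‖γ(φ)‖‖g‖ ≤ ⟪γ(φ), g⟫` — from `FST4.lemma1_plane_symmetric`
(`(k/K)‖γ(φ)‖ ≤ h(φ) = ⟪γ(φ), e(φ)⟫`), together with Lemma 1's radii `(G₀/g₀)⁻¹ ≤ ‖γ(φ)‖ ≤ (w₀/G₀)⁻¹`.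
[cite: FeldmanSalmhoferTrubowitz2000, Lemma 2 (proof) App. (A.3) p.20:L25-37; Lemma 1 §2.1 p.6:L29-55] -/
theorem angle_bound_symmetric {g₀ G₀ w₀ : ℝ} (hg₀ : 0 < g₀) (hw₀ : 0 < w₀) (hG₀ : max g₀ w₀ < G₀)
    (hh : ContDiff ℝ 2 h) (hper : Function.Periodic h (2 * Real.pi))
    (hsym : ∀ φ, h (φ + Real.pi) = h φ)
    (hρK : ∀ ψ, (G₀ / g₀)⁻¹ ≤ h ψ + iteratedDeriv 2 h ψ)
    (hρk : ∀ ψ, h ψ + iteratedDeriv 2 h ψ ≤ (w₀ / G₀)⁻¹) (φ : ℝ) {g : ℂ} {m : ℝ} (hm : 0 ≤ m)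
    (hg : g = m • unitVec φ) :
    ((G₀ / g₀)⁻¹ ≤ ‖supportCurve h φ‖ ∧ ‖supportCurve h φ‖ ≤ (w₀ / G₀)⁻¹) ∧
      (w₀ * g₀ / G₀ ^ 2) * (‖supportCurve h φ‖ * ‖g‖) ≤ ⟪supportCurve h φ, g⟫_ℝ := by
  have hG₀g : g₀ < G₀ := (le_max_left _ _).trans_lt hG₀
  have hG₀w : w₀ < G₀ := (le_max_right _ _).trans_lt hG₀
  have hG₀pos : 0 < G₀ := hg₀.trans hG₀g
  have hk : 0 < w₀ / G₀ := div_pos hw₀ hG₀pos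
  have hkK : w₀ / G₀ ≤ G₀ / g₀ := by
    rw [div_le_div_iff₀ hG₀pos hg₀]
    nlinarith
  have hL := lemma1_plane_symmetric h hk hkK hh hper hρK hρk hsym φ
  refine ⟨⟨hL.1, hL.2.1⟩, ?_⟩
  have hcK : w₀ / G₀ / (G₀ / g₀) = w₀ * g₀ / G₀ ^ 2 := by
    field_simp
  have h3 := hL.2.2.1
  rw [hcK] at h3
  have hng : ‖g‖ = m := by
    rw [hg, norm_smul, Real.norm_of_nonneg hm, norm_unitVec, mul_one]
  rw [hng, hg, real_inner_smul_right, inner_supportCurve_unitVec_self]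
  calc w₀ * g₀ / G₀ ^ 2 * (‖supportCurve h φ‖ * m) = m * (w₀ * g₀ / G₀ ^ 2 * ‖supportCurve h φ‖) := by
        ring
    _ ≤ m * h φ := mul_le_mul_of_nonneg_left h3 hm

/-- **The polar parametrisation of a symmetric convex Fermi curve exists** ("`S_e = {𝐩(r_F(e,θ),θ) :
θ ∈ S^{d−1}}` with `r_F : B × S^{d−1} → ℝ⁺`", p.6:L22–27), here for `S_E = range γ`: for `h ∈ C²`,
`2π`-periodic, centrally symmetric, with `1/K ≤ h + h″ ≤ 1/k`, every ray from the origin (the centre,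
by Lemma 1) meets the curve in EXACTLY ONE point `r_F(E,θ) θ`, `r_F(E,θ) > 0` (the body `B` contains
the ball of radius `1/K` about `0` and is compact and convex; last point of `B` on the ray; points of
`B` strictly between `0` and a point of `B` are interior).
[cite: FeldmanSalmhoferTrubowitz2000, §2.1 (polar coordinates) p.6:L13-27; Lemma 1 p.6:L55] -/
theorem existsUnique_fermiRadius {k K : ℝ} (hk : 0 < k) (hkK : k ≤ K) (hh : ContDiff ℝ 2 h)
    (hper : Function.Periodic h (2 * Real.pi)) (hρK : ∀ ψ, K⁻¹ ≤ h ψ + iteratedDeriv 2 h ψ)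
    (hρk : ∀ ψ, h ψ + iteratedDeriv 2 h ψ ≤ k⁻¹) (hsym : ∀ φ, h (φ + Real.pi) = h φ) (θ : ℂ)
    (hθ : ‖θ‖ = 1) :
    ∃ ρ : ℝ, 0 < ρ ∧ ρ • θ ∈ range (supportCurve h) ∧
      ∀ σ : ℝ, 0 ≤ σ → σ • θ ∈ range (supportCurve h) → σ = ρ := by
  have hB := rollingConvexBody_supportBody h hk hkK hh hper hρK hρk
  have hρ0 : ∀ ψ, 0 ≤ h ψ + iteratedDeriv 2 h ψ :=
    fun ψ => (inv_nonneg.2 (hk.le.trans hkK)).trans (hρK ψ)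
  have hfr := frontier_supportBody h hh hper hρ0
  have hne : (frontier (supportBody h)).Nonempty := ⟨_, supportCurve_mem_frontier h hh hper hρ0 0⟩
  obtain ⟨c₁, c₂, hc⟩ := exists_isMaxSeparated hB.isCompact hne
  have hS : ∀ p ∈ frontier (supportBody h), -p ∈ frontier (supportBody h) := by
    rw [hfr]
    rintro p ⟨φ', rfl⟩
    exact ⟨φ' + Real.pi, supportCurve_add_pi h hsym φ'⟩
  have hc0 : midpoint ℝ c₁ c₂ = 0 := hB.midpoint_eq_zero hc hS
  have hball : closedBall (0 : ℂ) K⁻¹ ⊆ supportBody h := by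
    have h1 := hB.closedBall_midpoint_subset hc
    rwa [hc0] at h1
  have hKpos : 0 < K := hk.trans_le hkK
  have h0int : (0 : ℂ) ∈ interior (supportBody h) :=
    interior_mono hball (ball_subset_interior_closedBall (mem_ball_self (inv_pos.2 hKpos)))
  have h0B : (0 : ℂ) ∈ supportBody h := interior_subset h0int
  have hθ0 : θ ≠ 0 := fun h0 => by simp [h0] at hθ
  obtain ⟨t, ht0, htfr, htmax⟩ := exists_mem_frontier_on_ray hB.isCompact h0B hθ0
  rw [zero_add] at htfr
  have htpos : 0 < t := by
    rcases ht0.lt_or_eq with hlt | heq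
    · exact hlt
    · exfalso
      rw [← heq, zero_smul] at htfr
      exact htfr.2 h0int
  refine ⟨t, htpos, by rw [← hfr]; exact htfr, fun σ hσ hσS => ?_⟩
  rw [← hfr] at hσS
  have hσB : (0 : ℂ) + σ • θ ∈ supportBody h := by
    rw [zero_add]; exact frontier_supportBody_subset h hσS
  have hσt : σ ≤ t := htmax σ hσ hσB
  rcases hσt.lt_or_eq with hlt | heq
  · exfalso
    -- `σ•θ` lies strictly between the interior point `0` and `t•θ ∈ B`: interior
    have htB : t • θ ∈ supportBody h := frontier_supportBody_subset h htfr
    have hmem := (convex_supportBody h).combo_interior_self_mem_interior h0int htB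
      (a := 1 - σ / t) (b := σ / t) (by rw [sub_pos, div_lt_one htpos]; exact hlt)
      (div_nonneg hσ htpos.le) (by ring)
    rw [smul_zero, zero_add, smul_smul, div_mul_cancel₀ _ htpos.ne'] at hmem
    exact hσS.2 hmem
  · exact heq

/-- **FST IV Lemma 2 in the plane, constants as printed** — `g₁ = w₀g₀²/(4G₀²)`, any
`0 < r₀ ≤ g₁/G₀` (so `r₀ = min{g₁/G₀, δ₀}`), for EVERY `E` of the class (uniformity in `E`): let the
Fermi curve of `E` be the centrally symmetric `C²` convex curve `γ = supportCurve h` (`E ∘ γ = 0`;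
`h ∈ C²`, `2π`-periodic, `h(φ+π) = h(φ)`, `h + h″ > 0`), `∇E` a gradient field of `E` with derivative
`E″`, and assume on the curve the class bounds (ii) `‖∇E‖ > g₀`, (iii) `‖∇E‖ ≤ G₀`, `(e′, E″e′) ≤ G₀`,
`∇E` `G₀`-Lipschitz, (iv) `(e′, E″ e′) > w₀` (unit tangent `e′(φ)`).  Then at every point
`𝐩 = γ(φ)` of `S_E`, with `ρ = ‖𝐩‖ = r_F(E, θ)`, `θ = 𝐩/‖𝐩‖`:
* `g₀/G₀ ≤ ‖𝐩‖ ≤ G₀/w₀` (Lemma 1) and `∂_r E(𝐩) ≥ 4g₁` ((A.3));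
* (A.6) `∂_r E(𝐩(r,θ)) ≥ 2g₁` for `|r − r_F(E,θ)| ≤ 2r₀`;
* for every `e` with gradient field `∇e` and `‖∇e − ∇E‖ ≤ g₁` (from `|e − E|₁ ≤ g₁`):
  (rg0) `∂_r e(𝐩(r,θ)) ≥ g₁` for `|r − r_F(E,θ)| ≤ 2r₀`, and, if `|e − E| ≤ r₀g₁` (from
  `|e − E|₀ ≤ r₀g₁`), (pfs) `e` has exactly one Fermi radius `r_F(e,θ)` on the collar ray and
  `|r_F(e,θ) − r_F(E,θ)| ≤ r₀`.
("We merely need to choose `ε < g₁`", and `ε ≤ r₀g₁`.)  The clause "`e ∈ 𝓔(δ₀/2,g₀/2,2G₀,w₀/2)`" is not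
asserted (module docstring, Scope).
[cite: FeldmanSalmhoferTrubowitz2000, Lemma 2 §2.1 p.6:L61-83; proof App. (A.1)-(A.8) p.20:L1-82] -/
theorem lemma2_plane {g₀ G₀ w₀ g₁ r₀ : ℝ} (hg₀ : 0 < g₀) (hw₀ : 0 < w₀) (hG₀ : max g₀ w₀ < G₀)
    (hg₁ : g₁ = w₀ * g₀ ^ 2 / (4 * G₀ ^ 2)) (hr₀ : 0 < r₀) (hr₀' : G₀ * r₀ ≤ g₁)
    (hh : ContDiff ℝ 2 h) (hper : Function.Periodic h (2 * Real.pi))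
    (hsym : ∀ φ, h (φ + Real.pi) = h φ) (hρ : ∀ φ, 0 < h φ + iteratedDeriv 2 h φ)
    {E : ℂ → ℝ} {gradE : ℂ → ℂ} {D : ℂ → (ℂ →L[ℝ] ℂ)}
    (hE : ∀ x, HasGradientAt E (gradE x) x) (hD : ∀ x, HasFDerivAt gradE (D x) x)
    (hF : ∀ φ, E (supportCurve h φ) = 0)
    (hii : ∀ φ, g₀ < ‖gradE (supportCurve h φ)‖)
    (hiii₁ : ∀ φ, ‖gradE (supportCurve h φ)‖ ≤ G₀)
    (hiii₂ : ∀ φ, ⟪D (supportCurve h φ) (unitVec' φ), unitVec' φ⟫_ℝ ≤ G₀)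
    (hLip : ∀ x y : ℂ, ‖gradE x - gradE y‖ ≤ G₀ * ‖x - y‖)
    (hiv : ∀ φ, w₀ < ⟪D (supportCurve h φ) (unitVec' φ), unitVec' φ⟫_ℝ) (φ : ℝ) :
    ((G₀ / g₀)⁻¹ ≤ ‖supportCurve h φ‖ ∧ ‖supportCurve h φ‖ ≤ (w₀ / G₀)⁻¹) ∧
    4 * g₁ ≤ ⟪gradE (supportCurve h φ), ‖supportCurve h φ‖⁻¹ • supportCurve h φ⟫_ℝ ∧
    (∀ r : ℝ, |r - ‖supportCurve h φ‖| ≤ 2 * r₀ →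
      2 * g₁ ≤ ⟪gradE (r • (‖supportCurve h φ‖⁻¹ • supportCurve h φ)),
        ‖supportCurve h φ‖⁻¹ • supportCurve h φ⟫_ℝ) ∧
    ∀ (e : ℂ → ℝ) (grade : ℂ → ℂ), (∀ x, HasGradientAt e (grade x) x) →
      (∀ x, ‖grade x - gradE x‖ ≤ g₁) →
        (∀ r : ℝ, |r - ‖supportCurve h φ‖| ≤ 2 * r₀ →
          g₁ ≤ ⟪grade (r • (‖supportCurve h φ‖⁻¹ • supportCurve h φ)),
            ‖supportCurve h φ‖⁻¹ • supportCurve h φ⟫_ℝ) ∧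
        ((∀ x, |e x - E x| ≤ r₀ * g₁) →
          ∃ r : ℝ, |r - ‖supportCurve h φ‖| ≤ r₀ ∧
            e (r • (‖supportCurve h φ‖⁻¹ • supportCurve h φ)) = 0 ∧
            ∀ s : ℝ, |s - ‖supportCurve h φ‖| ≤ 2 * r₀ →
              e (s • (‖supportCurve h φ‖⁻¹ • supportCurve h φ)) = 0 → s = r) := by
  -- constants
  have hG₀g : g₀ < G₀ := (le_max_left _ _).trans_lt hG₀
  have hG₀w : w₀ < G₀ := (le_max_right _ _).trans_lt hG₀
  have hG₀pos : 0 < G₀ := hg₀.trans hG₀g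
  have hg₁pos : 0 < g₁ := by rw [hg₁]; positivity
  -- the normal coefficient `m φ = ⟪∇E(γ φ), e φ⟫ = ‖∇E(γ φ)‖ > 0` and the curvature radius bounds
  have hdec : ∀ ψ, gradE (supportCurve h ψ) =
      (⟪gradE (supportCurve h ψ), unitVec ψ⟫_ℝ) • unitVec ψ :=
    fun ψ => grad_eq_smul_unitVec h hE hh (hρ ψ) hF
  have hcurv : ∀ ψ, (h ψ + iteratedDeriv 2 h ψ) *
      ⟪D (supportCurve h ψ) (unitVec' ψ), unitVec' ψ⟫_ℝ = ⟪gradE (supportCurve h ψ), unitVec ψ⟫_ℝ :=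
    fun ψ => curvature_formula h hE hD hh hρ hF ψ
  have hor : ∀ ψ, 0 < ⟪gradE (supportCurve h ψ), unitVec ψ⟫_ℝ ∧
      ‖gradE (supportCurve h ψ)‖ = ⟪gradE (supportCurve h ψ), unitVec ψ⟫_ℝ :=
    fun ψ => inner_grad_unitVec_pos h hE hD hh hρ hF (fun χ => hw₀.trans (hiv χ)) ψ
  have hmpos : ∀ ψ, 0 < ⟪gradE (supportCurve h ψ), unitVec ψ⟫_ℝ := fun ψ => (hor ψ).1
  have hnorm : ∀ ψ, ‖gradE (supportCurve h ψ)‖ = ⟪gradE (supportCurve h ψ), unitVec ψ⟫_ℝ :=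
    fun ψ => (hor ψ).2
  have hrad : ∀ ψ, (G₀ / g₀)⁻¹ ≤ h ψ + iteratedDeriv 2 h ψ ∧ h ψ + iteratedDeriv 2 h ψ ≤ (w₀ / G₀)⁻¹ :=
    fun ψ => curvatureRadius_bounds (hcurv ψ) hg₀ hw₀ ((hii ψ).le.trans_eq (hnorm ψ))
      ((hnorm ψ) ▸ hiii₁ ψ) (hiv ψ) (hiii₂ ψ)
  -- Lemma 1: radius bounds and the angle bound `cos θ ≥ w₀ g₀ / G₀²`
  have hang := angle_bound_symmetric h hg₀ hw₀ hG₀ hh hper hsym (fun ψ => (hrad ψ).1)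
    (fun ψ => (hrad ψ).2) φ (hmpos φ).le (hdec φ)
  -- the ray data
  have hp0 : supportCurve h φ ≠ 0 := by
    intro h0
    have h1 := hang.1.1
    rw [h0, norm_zero] at h1
    exact absurd h1 (not_le.2 (inv_pos.2 (div_pos hG₀pos hg₀)))
  have hnp : 0 < ‖supportCurve h φ‖ := norm_pos_iff.2 hp0
  have hθ : ‖‖supportCurve h φ‖⁻¹ • supportCurve h φ‖ = 1 := by
    rw [norm_smul, norm_inv, norm_norm, inv_mul_cancel₀ hnp.ne']
  have hpeq : ‖supportCurve h φ‖ • (‖supportCurve h φ‖⁻¹ • supportCurve h φ) = supportCurve h φ := by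
    rw [smul_smul, mul_inv_cancel₀ hnp.ne', one_smul]
  have hc : (0 : ℝ) ≤ w₀ * g₀ / G₀ ^ 2 := by positivity
  have hg₁' : 4 * g₁ = w₀ * g₀ / G₀ ^ 2 * g₀ := by rw [hg₁]; field_simp
  have hangle : w₀ * g₀ / G₀ ^ 2 *
      (‖‖supportCurve h φ‖ • (‖supportCurve h φ‖⁻¹ • supportCurve h φ)‖ *
        ‖gradE (‖supportCurve h φ‖ • (‖supportCurve h φ‖⁻¹ • supportCurve h φ))‖) ≤
      ⟪‖supportCurve h φ‖ • (‖supportCurve h φ‖⁻¹ • supportCurve h φ),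
        gradE (‖supportCurve h φ‖ • (‖supportCurve h φ‖⁻¹ • supportCurve h φ))⟫_ℝ := by
    rw [hpeq]; exact hang.2
  have hii' : g₀ ≤ ‖gradE (‖supportCurve h φ‖ • (‖supportCurve h φ‖⁻¹ • supportCurve h φ))‖ := by
    rw [hpeq]; exact (hii φ).le
  have hE0 : E (‖supportCurve h φ‖ • (‖supportCurve h φ‖⁻¹ • supportCurve h φ)) = 0 := by
    rw [hpeq]; exact hF φ
  have hLip' : ∀ r : ℝ, |r - ‖supportCurve h φ‖| ≤ 2 * r₀ →
      ‖gradE (r • (‖supportCurve h φ‖⁻¹ • supportCurve h φ)) -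
        gradE (‖supportCurve h φ‖ • (‖supportCurve h φ‖⁻¹ • supportCurve h φ))‖ ≤
        G₀ * |r - ‖supportCurve h φ‖| := by
    intro r _
    refine (hLip _ _).trans_eq ?_
    rw [← sub_smul, norm_smul, hθ, mul_one, Real.norm_eq_abs]
  have hray := lemma2_ray (E := E) hθ hnp hE0 hc hg₁' hangle hii' hLip' hG₀pos.le hr₀.le hr₀'
  have hA3 : 4 * g₁ ≤ ⟪gradE (supportCurve h φ), ‖supportCurve h φ‖⁻¹ • supportCurve h φ⟫_ℝ := by
    have h1 := radialDeriv_ge_of_angle hp0 hc hang.2 (hii φ).le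
    rwa [← hg₁'] at h1
  refine ⟨hang.1, hA3, hray.1, fun e grade he hnear => ?_⟩
  have h2 := hray.2 e grade he (fun r _ => hnear _)
  refine ⟨h2.1, fun hsup => h2.2 hg₁pos ?_⟩
  exact hsup _

/-- **Lemma 2 in the plane for `E ∈ C²`, in the vocabulary of the class `𝓔`** (`∇E = gradient E`,
`(t, E″(𝐩)t) = D²E(𝐩)(t,t) = iteratedFDeriv ℝ 2 E 𝐩 ![t, t]`, the form of `FST3.hessQuad` / condition
(iv) of `FST4.InDispersionClass`): the hypotheses (ii) `‖∇E‖ > g₀`, (iii) `‖∇E‖ ≤ G₀`, `(e′, E″e′) ≤ G₀`,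
`∇E` `G₀`-Lipschitz, (iv) `(e′, E″e′) > w₀` on the symmetric support-parametrised Fermi curve
`γ = supportCurve h` of `E` give the conclusions of `lemma2_plane` with `g₁ = w₀g₀²/(4G₀²)`: Lemma 1's
radii, (A.3) `∂_r E ≥ 4g₁` on `S_E`, (A.6) `∂_r E ≥ 2g₁` on the collar, and for every `e` with
`‖∇e − ∇E‖ ≤ g₁`: (rg0) `∂_r e ≥ g₁` on the collar and, if `|e − E| ≤ r₀g₁`, (pfs) the unique Fermi
radius of `e` on the collar ray within `r₀` of `r_F(E,θ)`.  (Via `hasGradientAt_gradient_and_hessian`.)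
[cite: FeldmanSalmhoferTrubowitz2000, Lemma 2 §2.1 p.6:L61-83; proof App. (A.1)-(A.8) p.20:L1-82; §1.2 (ii)-(iv) p.4:L38-43] -/
theorem lemma2_plane_of_contDiff_two {g₀ G₀ w₀ g₁ r₀ : ℝ} (hg₀ : 0 < g₀) (hw₀ : 0 < w₀)
    (hG₀ : max g₀ w₀ < G₀) (hg₁ : g₁ = w₀ * g₀ ^ 2 / (4 * G₀ ^ 2)) (hr₀ : 0 < r₀)
    (hr₀' : G₀ * r₀ ≤ g₁) (hh : ContDiff ℝ 2 h) (hper : Function.Periodic h (2 * Real.pi))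
    (hsym : ∀ φ, h (φ + Real.pi) = h φ) (hρ : ∀ φ, 0 < h φ + iteratedDeriv 2 h φ) {E : ℂ → ℝ}
    (hE : ContDiff ℝ 2 E) (hF : ∀ φ, E (supportCurve h φ) = 0)
    (hii : ∀ φ, g₀ < ‖gradient E (supportCurve h φ)‖)
    (hiii₁ : ∀ φ, ‖gradient E (supportCurve h φ)‖ ≤ G₀)
    (hiii₂ : ∀ φ, iteratedFDeriv ℝ 2 E (supportCurve h φ) ![unitVec' φ, unitVec' φ] ≤ G₀)
    (hLip : ∀ x y : ℂ, ‖gradient E x - gradient E y‖ ≤ G₀ * ‖x - y‖)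
    (hiv : ∀ φ, w₀ < iteratedFDeriv ℝ 2 E (supportCurve h φ) ![unitVec' φ, unitVec' φ]) (φ : ℝ) :
    ((G₀ / g₀)⁻¹ ≤ ‖supportCurve h φ‖ ∧ ‖supportCurve h φ‖ ≤ (w₀ / G₀)⁻¹) ∧
    4 * g₁ ≤ ⟪gradient E (supportCurve h φ), ‖supportCurve h φ‖⁻¹ • supportCurve h φ⟫_ℝ ∧
    (∀ r : ℝ, |r - ‖supportCurve h φ‖| ≤ 2 * r₀ →
      2 * g₁ ≤ ⟪gradient E (r • (‖supportCurve h φ‖⁻¹ • supportCurve h φ)),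
        ‖supportCurve h φ‖⁻¹ • supportCurve h φ⟫_ℝ) ∧
    ∀ (e : ℂ → ℝ) (grade : ℂ → ℂ), (∀ x, HasGradientAt e (grade x) x) →
      (∀ x, ‖grade x - gradient E x‖ ≤ g₁) →
        (∀ r : ℝ, |r - ‖supportCurve h φ‖| ≤ 2 * r₀ →
          g₁ ≤ ⟪grade (r • (‖supportCurve h φ‖⁻¹ • supportCurve h φ)),
            ‖supportCurve h φ‖⁻¹ • supportCurve h φ⟫_ℝ) ∧
        ((∀ x, |e x - E x| ≤ r₀ * g₁) →
          ∃ r : ℝ, |r - ‖supportCurve h φ‖| ≤ r₀ ∧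
            e (r • (‖supportCurve h φ‖⁻¹ • supportCurve h φ)) = 0 ∧
            ∀ s : ℝ, |s - ‖supportCurve h φ‖| ≤ 2 * r₀ →
              e (s • (‖supportCurve h φ‖⁻¹ • supportCurve h φ)) = 0 → s = r) := by
  obtain ⟨hgrad, D, hD, hDform⟩ := hasGradientAt_gradient_and_hessian hE
  have hiii₂' : ∀ ψ, ⟪D (supportCurve h ψ) (unitVec' ψ), unitVec' ψ⟫_ℝ ≤ G₀ :=
    fun ψ => (hDform _ _ _).trans_le (hiii₂ ψ)
  have hiv' : ∀ ψ, w₀ < ⟪D (supportCurve h ψ) (unitVec' ψ), unitVec' ψ⟫_ℝ :=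
    fun ψ => (hiv ψ).trans_eq (hDform _ _ _).symm
  exact lemma2_plane h hg₀ hw₀ hG₀ hg₁ hr₀ hr₀' hh hper hsym hρ hgrad hD hF hii hiii₁ hiii₂' hLip
    hiv' φ

end Plane

end FST4

end Literature.MathematicalPhysics.QuantumLattice.FermiRG
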